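import Literature.NumberTheory.Automorphic.Liu2021.CheckOfChiLocal
import Literature.NumberTheory.Automorphic.Liu2021.LemD1DataOfPlace
import HarnessLib

/-!
# `χ̌` over a finite place `v`: the product of the `w`-components of the global `χ̌` over `w ∣ v` is print's LOCAL `χ̌ = χ_v(x/xᶜ)`

[Liu2021, App. D §D.1 (l. 5224)]: «For `χ` in Step 3, we define a character `χ̌` of `E^×` via the formula `χ̌(x) = χ(x/xᶜ)`» —
at a finite place `v` of `F`, `E^× = E_v^× = Π_{w ∣ v} E_w^×` and `χ = χ_v` is the local component of the global automorphic
character.  The tree types this LOCAL `χ̌` as `OscillatorStandingData.check χ` (`LocalOscillatorStandingData`, used by ★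
`LemD1AsPrinted` for items (1) «`χ̌ = μ²`» and (4) «`μ′ = μᶜχ̌`») over the standing data AT THE PLACE `v`
(★ `LemD1OfPlace.standingData`, `E := E_v = Π_{w ∣ v} E_w`, `conj := c ⊗ 1`), and the GLOBAL `χ̌` as the Hecke character
★ `HeckeCharacter.checkOfChi hcc χ` (`CheckOfChi`).  This file proves they are the same thing place by place:

* `checkOfChi_prod_localUnits` — `χ̌(∏_{w ∣ v} ⟨x_w⟩_w) = χ(ι_v(x / xᶜ))`-bookkeeping in `U(1)(𝔸_{F,f})`
  (`finAdelicCheck_prod_unitsMap_finiteAdeleSingle`);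
* **`check_localCharOfCenter_comp_theta`** — for every `x ∈ E_vˣ`:
  `(standingData …).check (χ_v ∘ θ) x = ∏_{w ∣ v} χ̌_w(x_w)`, where `χ_v := UnitaryGroup.localCharOfCenter … χ v` is the tree's local
  component of `χ` at `v` and `θ : E_v¹ →* U(J₁)(F_v)` is ★ `LemD1OfPlace.theta` (print's scalar centre); i.e. the local `χ̌` of
  [Liu2021, §D.1] at `v` IS the `v`-part `∏_{w ∣ v} χ̌_w` of the global `χ̌`.  At a SPLIT place this refines to ★ p742948
  `localComponent_checkOfChi_det` (one factor per `w`); at an INERT or RAMIFIED place (`w` unique) it reads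
  `χ̌_w(x) = χ_v(x / c_w x)` (`localComponent_checkOfChi_of_placesOver_subsingleton`).

THEOREMS ONLY: no definition, no named fact, no instance, no `sorry`; count-neutral.  HC_CM is NOT proved by anything here.

## References
* [Liu2021] Y. Liu, *Fourier–Jacobi cycles and arithmetic relative trace formula*, Camb. J. Math. 9 (2021) = arXiv:2102.11518,
  App. D §D.1 (l. 5221–5224); Lemma D.1 (1), (4) (l. 5229, 5235).
* [CasselsFrohlichANT1967] Cassels–Fröhlich, *Algebraic Number Theory* (1967), Ch. II §§10–11, Ch. VII §1.1.
-/

set_option autoImplicit false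

noncomputable section

open NumberField IsDedekindDomain
open scoped RestrictedProduct Classical Matrix

namespace Literature.NumberTheory.Automorphic.Liu2021.CheckOfChi

open Literature.NumberTheory.GaloisRepresentations
open Literature.NumberTheory.Automorphic.UnitaryGroup
open Literature.NumberTheory.Automorphic.Liu2021.Def411WeilCarriers
open Literature.NumberTheory.Automorphic.Liu2021.LemD1OfPlace
open Literature.RepresentationTheory.Liu2021

/-! ## §1 Finite-adèle bookkeeping: `∏_{w ∣ v} ⟨x_w⟩_w` and its conjugate -/

section Adele

variable {E : Type} [Field E] [NumberField E]

/-- components of a product of finite adèles (the evaluation at `u` is a ring homomorphism, ★ `finiteAdeleEval`).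
[cite: CasselsFrohlichANT1967, Ch. II §11] -/
theorem finiteAdele_prod_apply {ι : Type} (s : Finset ι) (f : ι → FiniteAdeleRing (𝓞 E) E) (u : HeightOneSpectrum (𝓞 E)) :
    (∏ i ∈ s, f i) u = ∏ i ∈ s, f i u :=
  map_prod (AdelicGroupData.finiteAdeleEval E u) f s

/-- components of the inverse of a finite idèle: `(U⁻¹)_u = (U_u)⁻¹` in the field `E_u`. [cite: CasselsFrohlichANT1967, Ch. II §11] -/
theorem finiteIdele_inv_apply (U : (FiniteAdeleRing (𝓞 E) E)ˣ) (u : HeightOneSpectrum (𝓞 E)) :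
    ((U⁻¹ : (FiniteAdeleRing (𝓞 E) E)ˣ) : FiniteAdeleRing (𝓞 E) E) u = (((U : FiniteAdeleRing (𝓞 E) E) u))⁻¹ := by
  have h : (U : FiniteAdeleRing (𝓞 E) E) u * ((U⁻¹ : (FiniteAdeleRing (𝓞 E) E)ˣ) : FiniteAdeleRing (𝓞 E) E) u = 1 := by
    rw [← AdelicGroupData.finiteAdeleEval_apply, ← AdelicGroupData.finiteAdeleEval_apply, ← map_mul, Units.mul_inv, map_one]
  exact (eq_inv_of_mul_eq_one_right h)

end Adele

section Place

variable {F : Type} {E : Type} [Field F] [NumberField F] [Field E] [NumberField E] [Algebra F E] {c : E ≃ₐ[F] E}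

omit [NumberField F] in
/-- components of the inverse of a unit of `E_v = Π_{w ∣ v} E_w`: `(y⁻¹)_w = (y_w)⁻¹`. [cite: CasselsFrohlichANT1967, Ch. II §10] -/
theorem localRing_units_inv_apply {v : HeightOneSpectrum (𝓞 F)} (y : (UnitaryGroup.LocalRing E v)ˣ) (w : UnitaryGroup.PlacesOver E v) :
    ((y⁻¹ : (UnitaryGroup.LocalRing E v)ˣ) : UnitaryGroup.LocalRing E v) w = (((y : UnitaryGroup.LocalRing E v) w))⁻¹ := by
  have h : (y : UnitaryGroup.LocalRing E v) w * ((y⁻¹ : (UnitaryGroup.LocalRing E v)ˣ) : UnitaryGroup.LocalRing E v) w = 1 := by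
    rw [← Pi.mul_apply, Units.mul_inv, Pi.one_apply]
  exact (eq_inv_of_mul_eq_one_right h)

/-- the `u`-component of `∏_{w ∣ v} ⟨x_w⟩_w`: `x_u` if `u ∣ v`, else `1`. [cite: CasselsFrohlichANT1967, Ch. II §11] -/
theorem prod_finiteAdeleSingle_apply {v : HeightOneSpectrum (𝓞 F)} (x : UnitaryGroup.LocalRing E v) (u : HeightOneSpectrum (𝓞 E)) :
    (∏ w : UnitaryGroup.PlacesOver E v, finiteAdeleSingle w.1 (x w)) u =
      if hu : u.under (𝓞 F) = v then x ⟨u, hu⟩ else 1 := by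
  rw [finiteAdele_prod_apply]
  by_cases hu : u.under (𝓞 F) = v
  · rw [dif_pos hu, Finset.prod_eq_single (⟨u, hu⟩ : UnitaryGroup.PlacesOver E v)]
    · rw [finiteAdeleSingle_apply_self]
    · intro w _ hw
      exact finiteAdeleSingle_apply_of_ne _ fun h => hw (Subtype.ext h.symm)
    · intro h; exact absurd (Finset.mem_univ _) h
  · rw [dif_neg hu]
    refine Finset.prod_eq_one fun w _ => finiteAdeleSingle_apply_of_ne _ fun h => hu ?_
    rw [h]; exact w.2

/-- **`(∏_w ⟨x_w⟩_w) / (∏_w ⟨x_w⟩_w)ᶜ = ι_v(x / xᶜ)` in `U(1)(𝔸_{F,f})`**: the value of `finAdelicCheck` on the finite idèle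
with components `x_w` over `v` (and `1` elsewhere) is the point of `U(J₁)(𝔸_{F,f})` with `v`-component `θ(x / xᶜ)` read by
`finAdelicCenterInv = det` (`xᶜ = (c ⊗ 1) x`, ★ `conjLocal`; `θ` = ★ `LemD1OfPlace.theta`).
[cite: Liu2021, App. D §D.1 (l. 5221–5224)] [cite: CasselsFrohlichANT1967, Ch. VII §1.1] -/
theorem finAdelicCheck_prod_unitsMap_finiteAdeleSingle [Algebra.IsQuadraticExtension F E] (hcc : c * c = 1) {N : ℕ} {J : Matrix (Fin N) (Fin N) E}
    {v : HeightOneSpectrum (𝓞 F)} {δ : E} (hcδ : c δ = -δ) (hδ : δ ≠ 0) (hN : 2 ≤ N) (hJh : (J.map c)ᵀ = J)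
    (hJdet : J.det ≠ 0) {J₁ : Matrix (Fin 1) (Fin 1) E} (hJ₁ : J₁ 0 0 ≠ 0) (x : (UnitaryGroup.LocalRing E v)ˣ) :
    finAdelicCheck F E c hcc
        (∏ w : UnitaryGroup.PlacesOver E v,
          Units.map (finiteAdeleSingle w.1) (Units.map (Pi.evalRingHom _ w).toMonoidHom x)) =
      finAdelicCenterInv F E c J₁ hJ₁
        ((finAdelicEquiv F E c 1 J₁).symm (RestrictedProduct.mulSingle (fun v => localInt E c 1 J₁ v) v
          (theta E v c N J hcδ hδ hN hJh hJdet J₁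
            ((standingData E v c N J hcδ hδ hN hJh hJdet).divConj x)))) := by
  refine Subtype.ext (Units.ext (FiniteAdeleRing.ext E fun u => ?_))
  -- the right side, component at `u`
  rw [coe_finAdelicCenterInv, det_symm_mulSingle_apply]
  -- the left side, component at `u`: `(U / Uᶜ)_u = U_u · ((Uᶜ)_u)⁻¹`
  have hU : ((∏ w : UnitaryGroup.PlacesOver E v,
        Units.map (finiteAdeleSingle w.1) (Units.map (Pi.evalRingHom _ w).toMonoidHom x) : (FiniteAdeleRing (𝓞 E) E)ˣ) :
          FiniteAdeleRing (𝓞 E) E) =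
      ∏ w : UnitaryGroup.PlacesOver E v, finiteAdeleSingle w.1 ((x : UnitaryGroup.LocalRing E v) w) := by
    rw [Units.coe_prod]; rfl
  rw [coe_finAdelicCheck, div_eq_mul_inv, Units.val_mul]
  change ((_ : FiniteAdeleRing (𝓞 E) E) * _) u = _
  rw [show ∀ a b : FiniteAdeleRing (𝓞 E) E, (a * b) u = a u * b u from fun a b => rfl, finiteIdele_inv_apply, Units.coe_map,
    hU, prod_finiteAdeleSingle_apply]
  change _ * (conjFiniteAdele F E c (∏ w : UnitaryGroup.PlacesOver E v, finiteAdeleSingle w.1 ((x : UnitaryGroup.LocalRing E v) w)) u)⁻¹ = _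
  rw [conjFiniteAdele_apply_apply, prod_finiteAdeleSingle_apply]
  by_cases hu : u.under (𝓞 F) = v
  · have hu' : (c⁻¹ • u).under (𝓞 F) = v := by rw [HeightOneSpectrum.under_algEquiv_smul]; exact hu
    rw [dif_pos hu, dif_pos hu', dif_pos hu, coe_theta_apply, Matrix.diagonal_apply_eq,
      OscillatorStandingData.coe_divConj, div_eq_mul_inv, Units.val_mul, Pi.mul_apply, localRing_units_inv_apply,
      Units.coe_map]
    simp only [MonoidHom.coe_coe, OscillatorStandingData.σ_apply, standingData_conj_apply,
      conjLocal_apply]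
  · have hu' : ¬ (c⁻¹ • u).under (𝓞 F) = v := by rw [HeightOneSpectrum.under_algEquiv_smul]; exact hu
    rw [dif_neg hu, dif_neg hu', dif_neg hu, map_one, inv_one, mul_one]

/-! ## §2 The local `χ̌` of the standing data at `v` is the `v`-part of the global `χ̌` -/

/-- **`χ̌` of [Liu2021, §D.1] AT THE PLACE `v` is `∏_{w ∣ v} χ̌_w`**: for the global automorphic character `χ : Chi F E c`, its local
component `χ_v := localCharOfCenter … χ v` read on print's scalar centre `E_v¹` through `θ` (★ `LemD1OfPlace.theta`), and every
`x ∈ E_vˣ = Π_{w ∣ v} E_wˣ`: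
`(standingData …).check (χ_v ∘ θ) x = ∏_{w ∣ v} (checkOfChi hcc χ).localComponent w (x_w)` — print l. 5224 «`χ̌(x) = χ(x/xᶜ)`» read
at `v` on both sides. [cite: Liu2021, App. D §D.1 (l. 5221–5224); Lemma D.1 (1), (4) (l. 5229, 5235)] -/
theorem check_localCharOfCenter_comp_theta [Algebra.IsQuadraticExtension F E] (hcc : c * c = 1) (χ : Chi F E c) {N : ℕ} {J : Matrix (Fin N) (Fin N) E}
    {v : HeightOneSpectrum (𝓞 F)} {δ : E} (hcδ : c δ = -δ) (hδ : δ ≠ 0) (hN : 2 ≤ N) (hJh : (J.map c)ᵀ = J)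
    (hJdet : J.det ≠ 0) {J₁ : Matrix (Fin 1) (Fin 1) E} (hJ₁ : J₁ 0 0 ≠ 0) (x : (UnitaryGroup.LocalRing E v)ˣ) :
    (standingData E v c N J hcδ hδ hN hJh hJdet).check
        ((localCharOfCenter F E c J₁ hJ₁ (χ : finAdelicOne F E c →* ℂˣ) v).comp (theta E v c N J hcδ hδ hN hJh hJdet J₁)) x =
      ∏ w : UnitaryGroup.PlacesOver E v,
        (HeckeCharacter.checkOfChi hcc χ).localComponent w.1 (Units.map (Pi.evalRingHom _ w).toMonoidHom x) := by
  simp only [localComponent_checkOfChi_apply]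
  rw [← map_prod (χ : finAdelicOne F E c →* ℂˣ), ← map_prod (finAdelicCheck F E c hcc),
    finAdelicCheck_prod_unitsMap_finiteAdeleSingle hcc hcδ hδ hN hJh hJdet hJ₁, OscillatorStandingData.check_apply,
    MonoidHom.comp_apply, localCharOfCenter_apply]
  rfl

/-- **inert / ramified place** (a single `w ∣ v`): `χ̌_w(x_w) = (standingData …).check (χ_v ∘ θ) x` — the local `χ̌` of
[Liu2021, §D.1] IS the `w`-component of the global `χ̌`. [cite: Liu2021, App. D §D.1 (l. 5221–5224); Lemma D.1 (1) (l. 5229)] -/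
theorem localComponent_checkOfChi_of_placesOver_subsingleton [Algebra.IsQuadraticExtension F E] (hcc : c * c = 1) (χ : Chi F E c) {N : ℕ}
    {J : Matrix (Fin N) (Fin N) E} {v : HeightOneSpectrum (𝓞 F)} {δ : E} (hcδ : c δ = -δ) (hδ : δ ≠ 0) (hN : 2 ≤ N)
    (hJh : (J.map c)ᵀ = J) (hJdet : J.det ≠ 0) {J₁ : Matrix (Fin 1) (Fin 1) E} (hJ₁ : J₁ 0 0 ≠ 0)
    (w : UnitaryGroup.PlacesOver E v) (hw : ∀ w' : UnitaryGroup.PlacesOver E v, w' = w) (x : (UnitaryGroup.LocalRing E v)ˣ) :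
    (HeckeCharacter.checkOfChi hcc χ).localComponent w.1 (Units.map (Pi.evalRingHom _ w).toMonoidHom x) =
      (standingData E v c N J hcδ hδ hN hJh hJdet).check
        ((localCharOfCenter F E c J₁ hJ₁ (χ : finAdelicOne F E c →* ℂˣ) v).comp (theta E v c N J hcδ hδ hN hJh hJdet J₁)) x := by
  haveI : Subsingleton (UnitaryGroup.PlacesOver E v) := ⟨fun a b => (hw a).trans (hw b).symm⟩
  haveI : Unique (UnitaryGroup.PlacesOver E v) := uniqueOfSubsingleton w
  rw [check_localCharOfCenter_comp_theta hcc χ hcδ hδ hN hJh hJdet hJ₁, Fintype.prod_unique]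
  have : (default : UnitaryGroup.PlacesOver E v) = w := Subsingleton.elim _ _
  rw [this]

end Place

end Literature.NumberTheory.Automorphic.Liu2021.CheckOfChi

end
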